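/-
Copyright (c) 2026. All rights reserved.
Released under Apache 2.0 license as described in the file LICENSE.
Authors: abc-iut cell, statement-typer seat abc-iut-L4-t3 (wave 1).
-/
import Literature.AnabelianGeometry.AbsoluteAnabelian.LogFrobeniusTelecoreShiftCompat
import Literature.AnabelianGeometry.AbsoluteAnabelian.LogFrobeniusContactProofs

/-!
# [AbsTopIII] Corollary 5.5 (v), last sentence DISCHARGED: `cor55ShiftActionTelecore_holds`

S. Mochizuki, *Topics in absolute anabelian geometry III: global reconstruction algorithms*,
J. Math. Sci. Univ. Tokyo 22 (2015) 939–1156 [MochizukiAbsTopIII2015]; Cor 5.5 (v), last sentence, p. 132 ("these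
self-equivalences also extend naturally … to the diagram of categories … that constitutes the telecore of (ii), in a fashion
that is compatible with both the family of homotopies that constitutes this telecore structure … and the contact structure
`ℋ_{An•}` of (ii)"; proof p. 133: "immediate from the definitions and constructions made thus far").

Continuation of `LogFrobeniusTelecoreShift.lean` (the shift self-equivalences `Ψ_k` of `D_{An•}`) and
`LogFrobeniusTelecoreShiftCompat.lean` (invariance of the universal family `K` under the shifts). Here: the shifts are
bijective on paths (inverse shift; `telShift_exists_mapPath_eq`), the boundary sets of the telecore family `𝔍` (pairs through
`An•[𝒳]`) and of the contact structure `ℋ_{An•}` (the saturation of the printed generators, descending paths chosen uniformly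
in `⋎`) are shift-invariant (`univE_obs_telShift_iff`, `contactSaturation_telShift_iff`), whence the Def 3.5 (v)
compatibility (`OneMorphism.CompatibleWith`) of every `Ψ_k` with every shift-invariant restriction of `K`
(`telShiftCompatibleWith`) — in particular with `𝔍` and `ℋ_{An•}` — and **`cor55ShiftActionTelecore_holds`**: the typed
Cor 5.5 (v), last sentence (`Cor55ShiftActionTelecore`, `LogFrobeniusTelecoreExtensions.lean`) holds for every log-Frobenius
setting `L` with `V(F_mod) ≠ ∅`, witnessed by this seat's `contactTelecore` / `contactFamily` (`LogFrobeniusContactProofs.lean`)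
and `telShiftSelfEquivalence`; `cor55ShiftActionTelecore_iff_nonempty`. Pure category theory over the interface `L`;
refereed pre-IUT material; OUR kernel check of a typed statement; nothing here bears on [IUTchIII] Cor. 3.12.
-/

set_option autoImplicit false

universe u v' w'

open CategoryTheory Quiver

namespace Literature.AnabelianGeometry.AbsoluteAnabelian

/-! ## Bookkeeping on paths -/

section Quivers

variable {V : Type w'} [Quiver.{v'} V]

/-- `mapPath` respects heterogeneous equality of paths with equal endpoints. [folklore] -/
private theorem Prefunctor.mapPath_heq (F : V ⥤q V) {a b a' b' : V} (ha : a = a') (hb : b = b') {p : Path a b}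
    {p' : Path a' b'} (h : HEq p p') : HEq (F.mapPath p) (F.mapPath p') := by
  subst ha hb; cases h; rfl

/-- equal morphisms of oriented graphs have heterogeneously equal actions on paths. [folklore] -/
private theorem Prefunctor.mapPath_heq_of_eq {P Q : V ⥤q V} (H : P = Q) {a b : V} (p : Path a b) :
    HEq (P.mapPath p) (Q.mapPath p) := by
  subst H; rfl

end Quivers

namespace LogFrobeniusSetting

open DiagramOfCategories

variable {Vmod : Type u} {isArc : Vmod → Bool} (L : LogFrobeniusSetting Vmod isArc)

/-! ## The shifts are bijective on paths -/

/-- `shift (-k)` after `shift k` is the identity morphism of `Γ⃗_{D_{An•}}`. [cite: MochizukiAbsTopIII2015, Cor 5.5 (v) p. 132] -/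
theorem telShiftGraph_comp_neg (k : ℤ) :
    telShiftGraph (Vmod := Vmod) (isArc := isArc) k ⋙q telShiftGraph (-k) = 𝟭q _ := by
  rw [telShiftGraph_comp, Int.add_right_neg, telShiftGraph_zero]

/-- the vertices: `(w + k) - k = w`. [cite: MochizukiAbsTopIII2015, Cor 5.5 (v) p. 132] -/
theorem telShiftObj_neg_telShiftObj (k : ℤ) (w : (anTelecoreShape (Vmod := Vmod) (isArc := isArc) anTelJ).Vertex) :
    telShiftObj (-k) (telShiftObj k w) = w :=
  congrArg (fun H : (anTelecoreShape (Vmod := Vmod) (isArc := isArc) anTelJ).Vertex ⥤q _ => H.obj w)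
    (telShiftGraph_comp_neg k)

/-- the shift by `k` reaches every path between shifted vertices: `Φ (Φ⁻¹ γ') = γ'`. [cite: MochizukiAbsTopIII2015, Cor 5.5 (v) p. 132] -/
theorem telShift_mapPath_cast (k : ℤ) {a b : (anTelecoreShape (Vmod := Vmod) (isArc := isArc) anTelJ).Vertex}
    (p' : Path (telShiftObj k a) (telShiftObj k b)) :
    (telShiftGraph k).mapPath (((telShiftGraph (-k)).mapPath p').cast (telShiftObj_neg_telShiftObj k a)
      (telShiftObj_neg_telShiftObj k b)) = p' := by
  apply eq_of_heq
  refine (Prefunctor.mapPath_heq (telShiftGraph k) (telShiftObj_neg_telShiftObj k a).symm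
    (telShiftObj_neg_telShiftObj k b).symm (Path.cast_heq _ _ _)).trans ?_
  refine (heq_of_eq (Prefunctor.mapPath_comp_apply (telShiftGraph (-k)) (telShiftGraph k) p').symm).trans ?_
  have h : telShiftGraph (Vmod := Vmod) (isArc := isArc) (-k) ⋙q telShiftGraph k = 𝟭q _ := by
    rw [telShiftGraph_comp, Int.add_left_neg, telShiftGraph_zero]
  exact (Prefunctor.mapPath_heq_of_eq h p').trans (heq_of_eq (Prefunctor.mapPath_id p'))

/-! ## The boundary sets of `𝔍` and `ℋ_{An•}` are shift-invariant -/

/-- a shift-invariance predicate for boundary sets on `Γ⃗_{D_{An•}}`: closed under ALL shifts. [cite: MochizukiAbsTopIII2015, Cor 5.5 (v) p. 132] -/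
def IsShiftStable (E : ∀ ⦃a b : (anTelecoreShape (Vmod := Vmod) (isArc := isArc) anTelJ).Vertex⦄, Path a b → Path a b → Prop) :
    Prop :=
  ∀ (k : ℤ) ⦃a b : (anTelecoreShape (Vmod := Vmod) (isArc := isArc) anTelJ).Vertex⦄ ⦃p q : Path a b⦄, E p q →
    E ((telShiftGraph k).mapPath p) ((telShiftGraph k).mapPath q)

/-- transport of a pair along a morphism of oriented graphs equal to the identity (bookkeeping). [folklore] -/
private theorem IsShiftStable.of_eq_id
    {E : ∀ ⦃a b : (anTelecoreShape (Vmod := Vmod) (isArc := isArc) anTelJ).Vertex⦄, Path a b → Path a b → Prop}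
    {P : (anTelecoreShape (Vmod := Vmod) (isArc := isArc) anTelJ).Vertex ⥤q
      (anTelecoreShape (Vmod := Vmod) (isArc := isArc) anTelJ).Vertex} (H : P = 𝟭q _)
    {a b : (anTelecoreShape (Vmod := Vmod) (isArc := isArc) anTelJ).Vertex} {p q : Path a b}
    (h : E (P.mapPath p) (P.mapPath q)) : E p q := by
  subst H
  rw [Prefunctor.mapPath_id, Prefunctor.mapPath_id] at h
  exact h

/-- a shift-stable boundary set is shift-INVARIANT (use the inverse shift). [cite: MochizukiAbsTopIII2015, Cor 5.5 (v) p. 132] -/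
theorem IsShiftStable.iff {E : ∀ ⦃a b : (anTelecoreShape (Vmod := Vmod) (isArc := isArc) anTelJ).Vertex⦄,
      Path a b → Path a b → Prop} (hE : IsShiftStable E) (k : ℤ)
    {a b : (anTelecoreShape (Vmod := Vmod) (isArc := isArc) anTelJ).Vertex} (p q : Path a b) :
    E p q ↔ E ((telShiftGraph k).mapPath p) ((telShiftGraph k).mapPath q) := by
  refine ⟨fun h => hE k h, fun h => ?_⟩
  have h' := hE (-k) h
  rw [← Prefunctor.mapPath_comp_apply, ← Prefunctor.mapPath_comp_apply] at h'
  exact IsShiftStable.of_eq_id (telShiftGraph_comp_neg k) h'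

/-- the boundary set of the telecore family `𝔍` — the pairs `([γ₃]∘[γ₁], [γ₃]∘[γ₂])` through `An•[𝒳]` — is shift-stable.
[cite: MochizukiAbsTopIII2015, Cor 5.5 (v) p. 132] -/
theorem univE_obs_shiftStable :
    IsShiftStable (Vmod := Vmod) (isArc := isArc)
      (univE (· = (anTelecoreShape (Vmod := Vmod) (isArc := isArc) anTelJ).obs)) := by
  rintro k a b p q ⟨⟨w, hw, p₁, q₁, s, hp, hq⟩⟩
  subst hw
  refine ⟨⟨(telShiftGraph k).obj (anTelecoreShape anTelJ).obs, rfl, (telShiftGraph k).mapPath p₁,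
    (telShiftGraph k).mapPath q₁, (telShiftGraph k).mapPath s, ?_, ?_⟩⟩
  · rw [hp, Prefunctor.mapPath_comp]
  · rw [hq, Prefunctor.mapPath_comp]

/-- the saturation of a shift-stable set of pairs is shift-stable. [cite: MochizukiAbsTopIII2015, Cor 5.5 (v) p. 132] -/
theorem saturation_shiftStable {E : ∀ ⦃a b : (anTelecoreShape (Vmod := Vmod) (isArc := isArc) anTelJ).Vertex⦄,
      Path a b → Path a b → Prop} (hE : IsShiftStable E) : IsShiftStable (Saturation E) := by
  intro k a b p q h
  induction h with
  | base h => exact Saturation.base (hE k h)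
  | refl_left _ ih => exact ih.refl_left
  | refl_right _ ih => exact ih.refl_right
  | trans _ _ ih₁ ih₂ => exact ih₁.trans ih₂
  | precomp r _ ih =>
    rw [Prefunctor.mapPath_comp, Prefunctor.mapPath_comp]
    exact ih.precomp _
  | postcomp r _ ih =>
    rw [Prefunctor.mapPath_comp, Prefunctor.mapPath_comp]
    exact ih.postcomp _

section Generators

variable (v₀ : Vmod) (ν₀ : LogVertex (isArc v₀)) (hν₀ : ν₀.isPostLog = false)

/-- the shifted generator paths. [folklore] -/
private theorem telShift_phiCorePath (k : ℤ) (jc : anTelJ (isArc := isArc) ⟨.core, core_mem_five⟩) :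
    (telShiftGraph k).mapPath (phiCorePath anTelJ jc) = phiCorePath anTelJ (telIdxShift k .core jc) := rfl

/-- the shifted generator paths, `[id_⋎] ∘ [φ_⋎]`. [folklore] -/
private theorem telShift_phiRowPath (k n : ℤ) (jn : anTelJ (isArc := isArc) ⟨.row1 n, row1_mem_five n⟩) :
    (telShiftGraph k).mapPath (phiRowPath anTelJ n jn) = phiRowPath anTelJ (n + k) (telIdxShift k (.row1 n) jn) := rfl

/-- the shifted generator paths, `[β¹_□]`. [folklore] -/
private theorem telShift_betaCorePath (k : ℤ) (jc : anTelJ (isArc := isArc) ⟨.core, core_mem_five⟩) :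
    (telShiftGraph k).mapPath (betaCorePath anTelJ v₀ ν₀ hν₀ jc) =
      betaCorePath anTelJ v₀ ν₀ hν₀ (telIdxShift k .core jc) := rfl

/-- the shifted generator paths, `[β¹_⋎]`. [folklore] -/
private theorem telShift_betaRowPath (k n : ℤ) (jn : anTelJ (isArc := isArc) ⟨.row1 n, row1_mem_five n⟩) :
    (telShiftGraph k).mapPath (betaRowPath anTelJ n v₀ ν₀ hν₀ jn) =
      betaRowPath anTelJ (n + k) v₀ ν₀ hν₀ (telIdxShift k (.row1 n) jn) := rfl

/-- the printed generating pairs of `ℋ_{An•}` — for a descending path chosen UNIFORMLY in `⋎` — form a shift-stable set.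
[cite: MochizukiAbsTopIII2015, Cor 5.5 (v) p. 132] -/
theorem contactGen_shiftStable :
    IsShiftStable (Vmod := Vmod) (isArc := isArc)
      (contactGen v₀ ν₀ hν₀ (fun _ => v₀) (fun _ => ν₀) (fun _ => hν₀)) := by
  intro k a b p q h
  rcases h with ⟨n, jc, jn, rfl, rfl, h⟩ | ⟨jc, rfl, rfl, h⟩ | ⟨n, jn, rfl, rfl, h⟩
  · refine Or.inl ⟨n + k, telIdxShift k .core jc, telIdxShift k (.row1 n) jn, rfl, rfl, ?_⟩
    rcases h with ⟨hp, hq⟩ | ⟨hp, hq⟩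
    · cases hp; cases hq; exact Or.inl ⟨HEq.rfl, HEq.rfl⟩
    · cases hp; cases hq; exact Or.inr ⟨HEq.rfl, HEq.rfl⟩
  · refine Or.inr (Or.inl ⟨telIdxShift k .core jc, rfl, rfl, ?_⟩)
    rcases h with ⟨hp, hq⟩ | ⟨hp, hq⟩
    · cases hp; cases hq; exact Or.inl ⟨HEq.rfl, HEq.rfl⟩
    · cases hp; cases hq; exact Or.inr ⟨HEq.rfl, HEq.rfl⟩
  · refine Or.inr (Or.inr ⟨n + k, telIdxShift k (.row1 n) jn, rfl, rfl, ?_⟩)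
    rcases h with ⟨hp, hq⟩ | ⟨hp, hq⟩
    · cases hp; cases hq; exact Or.inl ⟨HEq.rfl, HEq.rfl⟩
    · cases hp; cases hq; exact Or.inr ⟨HEq.rfl, HEq.rfl⟩

end Generators

/-! ## The isomorphisms `Φ_{[γ]}` of the shifts; their components are `eqToHom`s -/

section EqToHomCalculus

variable {C : Type (u + 1)} [Category.{u} C] {C' : Type (u + 1)} [Category.{u} C']

/-- an identity is an `eqToHom`. [folklore] -/
private theorem exists_eq_eqToHom_id'' (X : C) : ∃ h : X = X, 𝟙 X = eqToHom h := ⟨rfl, rfl⟩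

/-- a composite of two `eqToHom`s is an `eqToHom`. [folklore] -/
private theorem exists_eq_eqToHom_comp'' {X Y Z : C} {f : X ⟶ Y} {g : Y ⟶ Z} (hf : ∃ h, f = eqToHom h)
    (hg : ∃ h, g = eqToHom h) : ∃ h, f ≫ g = eqToHom h := by
  obtain ⟨p, rfl⟩ := hf
  obtain ⟨q, rfl⟩ := hg
  exact ⟨p.trans q, eqToHom_trans p q⟩

/-- a functor maps an `eqToHom` to an `eqToHom`. [folklore] -/
private theorem exists_eq_eqToHom_map'' (F : C ⥤ C') {X Y : C} {f : X ⟶ Y} (hf : ∃ h, f = eqToHom h) :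
    ∃ h, F.map f = eqToHom h := by
  obtain ⟨p, rfl⟩ := hf
  exact ⟨congrArg F.obj p, eqToHom_map F p⟩

/-- a component of an `eqToHom` between functors is an `eqToHom`. [folklore] -/
private theorem exists_eq_eqToHom_app'' {A : Type (u + 1)} [Category.{u} A] {F G : A ⥤ C} {α : F ⟶ G}
    (hα : ∃ h, α = eqToHom h) (X : A) : ∃ h, α.app X = eqToHom h := by
  obtain ⟨p, rfl⟩ := hα
  exact ⟨Functor.congr_obj p X, eqToHom_app p X⟩

/-- "every component is an `eqToHom`", for an isomorphism of functors. [folklore] -/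
private def IsEqToHomApp {A : Type (u + 1)} [Category.{u} A] {F G : A ⥤ C} (i : F ≅ G) : Prop :=
  ∀ x : A, ∃ h, i.hom.app x = eqToHom h

/-- "every component is an `eqToHom`": closed under composition (bookkeeping). [folklore] -/
private theorem isEqToHomApp_trans {A : Type (u + 1)} [Category.{u} A] {F G H : A ⥤ C} {i : F ≅ G} {j : G ≅ H}
    (hi : IsEqToHomApp i) (hj : IsEqToHomApp j) : IsEqToHomApp (i ≪≫ j) :=
  fun x => exists_eq_eqToHom_comp'' (hi x) (hj x)

/-- "every component is an `eqToHom`": `eqToIso` (bookkeeping). [folklore] -/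
private theorem isEqToHomApp_eqToIso {A : Type (u + 1)} [Category.{u} A] {F G : A ⥤ C} (h : F = G) :
    IsEqToHomApp (eqToIso h) :=
  fun x => exists_eq_eqToHom_app'' ⟨h, eqToIso.hom h⟩ x

/-- "every component is an `eqToHom`": right unitor (bookkeeping). [folklore] -/
private theorem isEqToHomApp_rightUnitor {A : Type (u + 1)} [Category.{u} A] (F : A ⥤ C) : IsEqToHomApp F.rightUnitor :=
  fun x => exists_eq_eqToHom_id'' (F.obj x)

/-- "every component is an `eqToHom`": inverse left unitor (bookkeeping). [folklore] -/
private theorem isEqToHomApp_leftUnitor_symm {A : Type (u + 1)} [Category.{u} A] (F : A ⥤ C) :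
    IsEqToHomApp F.leftUnitor.symm :=
  fun x => exists_eq_eqToHom_id'' (F.obj x)

/-- "every component is an `eqToHom`": associator (bookkeeping). [folklore] -/
private theorem isEqToHomApp_associator {A B : Type (u + 1)} [Category.{u} A] [Category.{u} B] (F : A ⥤ B) (G : B ⥤ C')
    (H : C' ⥤ C) : IsEqToHomApp (Functor.associator F G H) :=
  fun _ => exists_eq_eqToHom_id'' _

/-- "every component is an `eqToHom`": inverse associator (bookkeeping). [folklore] -/
private theorem isEqToHomApp_associator_symm {A B : Type (u + 1)} [Category.{u} A] [Category.{u} B] (F : A ⥤ B)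
    (G : B ⥤ C') (H : C' ⥤ C) : IsEqToHomApp (Functor.associator F G H).symm :=
  fun _ => exists_eq_eqToHom_id'' _

/-- "every component is an `eqToHom`": right whiskering (bookkeeping). [folklore] -/
private theorem isEqToHomApp_isoWhiskerRight {A : Type (u + 1)} [Category.{u} A] {F G : A ⥤ C'} {i : F ≅ G}
    (hi : IsEqToHomApp i) (T : C' ⥤ C) : IsEqToHomApp (Functor.isoWhiskerRight i T) :=
  fun x => exists_eq_eqToHom_map'' T (hi x)

/-- "every component is an `eqToHom`": left whiskering (bookkeeping). [folklore] -/
private theorem isEqToHomApp_isoWhiskerLeft {A B : Type (u + 1)} [Category.{u} A] [Category.{u} B] (S : A ⥤ B)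
    {F G : B ⥤ C} {i : F ≅ G} (hi : IsEqToHomApp i) : IsEqToHomApp (Functor.isoWhiskerLeft S i) :=
  fun x => hi (S.obj x)

end EqToHomCalculus

/-- the isomorphisms `Φ_{[γ]} : Φ_a ⋙ 𝒟_[Φγ] ≅ 𝒟_[γ] ⋙ Φ_b` of the shift `Φ = Ψ_k` along paths, composed from the 2-cells
`Φ_e` exactly as prescribed by `OneMorphism.CompatibleWith` (Def 3.5 (v)). [cite: MochizukiAbsTopIII2015, Definition 3.5 (v) p.76] -/
noncomputable def telShiftPathIso (k : ℤ) {a : (anTelecoreShape (Vmod := Vmod) (isArc := isArc) anTelJ).Vertex} :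
    ∀ {b : (anTelecoreShape (Vmod := Vmod) (isArc := isArc) anTelJ).Vertex} (p : Path a b),
      (L.telShiftOneMorphism k).app a ⋙
          (L.anTelecoreDiagram anTelJ (fun {a} j => L.telecoreFun a.1 j)).pathFunctor ((telShiftGraph k).mapPath p) ≅
        (L.anTelecoreDiagram anTelJ (fun {a} j => L.telecoreFun a.1 j)).pathFunctor p ⋙ (L.telShiftOneMorphism k).app b
  | _, .nil =>
    eqToIso (by rw [Prefunctor.mapPath_nil, pathFunctor_nil]) ≪≫
      (((L.telShiftOneMorphism k).app a).rightUnitor ≪≫ ((L.telShiftOneMorphism k).app a).leftUnitor.symm) ≪≫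
      eqToIso (by rw [pathFunctor_nil])
  | _, .cons p e =>
    eqToIso (by rw [Prefunctor.mapPath_cons, pathFunctor_cons]) ≪≫
      ((Functor.associator _ _ _).symm ≪≫
        Functor.isoWhiskerRight (telShiftPathIso k p)
          ((L.anTelecoreDiagram anTelJ (fun {a} j => L.telecoreFun a.1 j)).map ((telShiftGraph k).map e)) ≪≫
        Functor.associator _ _ _ ≪≫
        Functor.isoWhiskerLeft ((L.anTelecoreDiagram anTelJ (fun {a} j => L.telecoreFun a.1 j)).pathFunctor p)
          ((L.telShiftOneMorphism k).iso e) ≪≫ (Functor.associator _ _ _).symm) ≪≫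
      eqToIso (by rw [pathFunctor_cons])

/-- the components of `Φ_{[γ]}` are `eqToHom`s (the 2-cells of the shift are `eqToIso`s). [folklore] -/
private theorem telShiftPathIso_isEqToHomApp (k : ℤ) {a : (anTelecoreShape (Vmod := Vmod) (isArc := isArc) anTelJ).Vertex} :
    ∀ {b : (anTelecoreShape (Vmod := Vmod) (isArc := isArc) anTelJ).Vertex} (p : Path a b),
      IsEqToHomApp (L.telShiftPathIso k p)
  | _, .nil => by
    rw [telShiftPathIso]
    exact isEqToHomApp_trans (isEqToHomApp_eqToIso _)
      (isEqToHomApp_trans (isEqToHomApp_trans (isEqToHomApp_rightUnitor _) (isEqToHomApp_leftUnitor_symm _))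
        (isEqToHomApp_eqToIso _))
  | _, .cons p e => by
    rw [telShiftPathIso]
    refine isEqToHomApp_trans (isEqToHomApp_eqToIso _) (isEqToHomApp_trans ?_ (isEqToHomApp_eqToIso _))
    refine isEqToHomApp_trans (isEqToHomApp_associator_symm _ _ _)
      (isEqToHomApp_trans (isEqToHomApp_isoWhiskerRight (telShiftPathIso_isEqToHomApp k p) _)
        (isEqToHomApp_trans (isEqToHomApp_associator _ _ _)
          (isEqToHomApp_trans (isEqToHomApp_isoWhiskerLeft _ (isEqToHomApp_eqToIso _))
            (isEqToHomApp_associator_symm _ _ _))))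

/-! ## Def 3.5 (v) compatibility of the shifts with the shift-stable restrictions of `K` -/

/-- **the shift `Ψ_k` is compatible (Def 3.5 (v)) with every shift-stable restriction of the universal family `K`**: the
shift induces a bijection of the boundary set onto itself, and the homotopies commute with the 2-cells `Φ_{[γ]}` — by the
invariance of `K` under the shifts (`telShift_univ_η_heq`). [cite: MochizukiAbsTopIII2015, Cor 5.5 (v) p. 132] -/
noncomputable def telShiftCompatibleWith (k : ℤ)
    (E : ∀ ⦃a b : (anTelecoreShape (Vmod := Vmod) (isArc := isArc) anTelJ).Vertex⦄, Path a b → Path a b → Prop)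
    (hE : IsSaturated E) (hsub : ∀ ⦃a b⦄ ⦃p q : Path a b⦄, E p q → (L.contactUniv).E p q) (hEst : IsShiftStable E) :
    (L.telShiftOneMorphism k).CompatibleWith ((L.contactUniv).restrictBoundary E hE hsub)
      ((L.contactUniv).restrictBoundary E hE hsub) where
  pathIso p := L.telShiftPathIso k p
  pathIso_nil _ := rfl
  pathIso_cons _ _ := by rw [telShiftPathIso]
  boundary_iff p q := hEst.iff k p q
  boundary_surj p' q' _ :=
    ⟨((telShiftGraph (-k)).mapPath p').cast (telShiftObj_neg_telShiftObj k _) (telShiftObj_neg_telShiftObj k _),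
      ((telShiftGraph (-k)).mapPath q').cast (telShiftObj_neg_telShiftObj k _) (telShiftObj_neg_telShiftObj k _),
      telShift_mapPath_cast k p', telShift_mapPath_cast k q'⟩
  η_compat {a b} p q h := by
    ext x
    obtain ⟨h₁, e₁⟩ := L.telShiftPathIso_isEqToHomApp k p x
    obtain ⟨h₂, e₂⟩ := L.telShiftPathIso_isEqToHomApp k q x
    have HEQ := L.telShift_univ_η_heq k (hsub h) (hsub ((hEst.iff k p q).mp h)) x
    rw [NatTrans.comp_app, NatTrans.comp_app, Functor.whiskerLeft_app, Functor.whiskerRight_app, e₁, e₂]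
    refine (comp_eqToHom_iff h₂ _ _).2 ?_
    rw [Category.assoc]
    exact (conj_eqToHom_iff_heq _ _ h₁ h₂).2 HEQ

/-! ## Cor 5.5 (v), last sentence: the theorem -/

section Holds

variable [Nonempty Vmod]

/-- `ℋ_{An•}` (descending path through `λ⊞_{v₀,ν₀}`, uniformly in `⋎`) is generated by the printed homotopies on the printed
pairs (`IsAnContactGenerated`; assembled from `contactFamily_etaSq/etaCore/etaRow` of `LogFrobeniusContactProofs.lean`).
[cite: MochizukiAbsTopIII2015, Cor 5.5 (ii) p. 131] -/
theorem contactFamily_isAnContactGenerated (v₀ : Vmod) (ν₀ : LogVertex (isArc v₀)) (hν₀ : ν₀.isPostLog = false) :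
    L.IsAnContactGenerated L.contactTelecore (L.contactFamily v₀ ν₀ hν₀ (fun _ => v₀) (fun _ => ν₀) (fun _ => hν₀)) :=
  ⟨v₀, ν₀, hν₀, fun _ => v₀, fun _ => ν₀, fun _ => hν₀, fun _ _ _ _ => Iff.rfl,
    fun n jc jn hmem A => L.contactFamily_etaSq _ _ _ _ _ _ n jc jn hmem A,
    fun jc hmem X₀ => L.contactFamily_etaCore _ _ _ _ _ _ jc hmem X₀,
    fun n jn hmem X₀ => L.contactFamily_etaRow _ _ _ _ _ _ n jn hmem X₀⟩

/-- **Cor 5.5 (v), last sentence, DISCHARGED** for every log-Frobenius setting `L` with `V(F_mod) ≠ ∅`: the telecore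
`𝔗_{An•}` (`contactTelecore`) with its contact structure `ℋ_{An•}` (`contactFamily`, generated by the printed homotopies) admits,
for every `k`, the self-equivalence `Ψ_k = telShiftSelfEquivalence k` of `D_{An•}` extending the shift by `k`, compatible in
the sense of Def 3.5 (v) with the telecore family `𝔍` and with `ℋ_{An•}`. [cite: MochizukiAbsTopIII2015, Cor 5.5 (v) p. 132] -/
theorem cor55ShiftActionTelecore_holds : L.Cor55ShiftActionTelecore := by
  obtain ⟨v₀⟩ := ‹Nonempty Vmod›
  refine ⟨_, _, univCoreObs_isCore (obsShape InFive .an) (fun _ => (inferInstance : IsEmpty PEmpty.{u + 1}))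
      (L.obsExt InFive .an) L.contactBase L.φAn L.contactObsIso L.φAnFullyFaithful reach_an,
    L.contactTelecore, rfl, HEq.rfl,
    L.contactFamily v₀ (LogVertex.spaceLink _) (spaceLink_isPostLog _) (fun _ => v₀)
      (fun _ => LogVertex.spaceLink _) (fun _ => spaceLink_isPostLog _),
    fun k => L.telShiftSelfEquivalence k,
    L.contactFamily_isContactStructure _ _ _ _ _ _, L.contactFamily_isAnContactGenerated _ _ _,
    fun k => L.telShift_extendsShift k, fun k => ⟨⟨?_⟩, ⟨?_⟩⟩⟩
  · exact L.telShiftCompatibleWith k _ (isSaturated_univE _) _ univE_obs_shiftStable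
  · exact L.telShiftCompatibleWith k _ (isSaturated_saturation _) _
      (saturation_shiftStable (contactGen_shiftStable v₀ (LogVertex.spaceLink _) (spaceLink_isPostLog _)))

omit [Nonempty Vmod] in
/-- Cor 5.5 (v), last sentence, as typed, holds if and only if `V(F_mod) ≠ ∅`. [cite: MochizukiAbsTopIII2015, Cor 5.5 (v) p. 132] -/
theorem cor55ShiftActionTelecore_iff_nonempty : L.Cor55ShiftActionTelecore ↔ Nonempty Vmod := by
  refine ⟨fun h => ?_, fun _ => L.cor55ShiftActionTelecore_holds⟩
  by_contra hV
  rw [not_nonempty_iff] at hV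
  exact L.not_cor55ShiftActionTelecore_of_isEmpty h

end Holds

end LogFrobeniusSetting

end Literature.AnabelianGeometry.AbsoluteAnabelian
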